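import Summits.Ventures.HodgeRepro2.T5LevelIdempotentDual

/-!
# Level-`K` Hecke operators `e_K ρ(g) e_K` on `V^K` (Tier-5 kernel support, seat p8)

For `K`-finite `ρ` in characteristic `0` (smooth `ρ`, compact open `K`), the operator
`T_g := e_K ∘ ρ g ∘ e_K` restricted to `V^K` (`heckeOp`) depends only on the double coset
`K g K` (`heckeOp_doubleCoset`), is the identity for `g ∈ K`, and on `V^K` it is
`x ↦ e_K (ρ g x)` (`heckeOp_apply`).  This is the action of the double-coset generators
`[K g K]` of the Hecke algebra `H(G, K) = e_K H(G) e_K` on `π^K`, stated without Haar measure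
(the normalisation of `[K g K]` by `vol(K)`, and the convolution structure of `H(G, K)` itself,
stay prose).  Nothing is asserted about any specific group.
-/

namespace Summit.Ventures.HodgeRepro2.T5HeckeOperator

open Summit.Ventures.HodgeRepro2.LevelPositivity Summit.Ventures.HodgeRepro2.T5LevelIdempotent
  Summit.Ventures.HodgeRepro2.T5LevelIdempotentDual

variable {G : Type*} [Group G] {k : Type*} [Field k] [CharZero k] {V : Type*} [AddCommGroup V]
  [Module k V] (ρ : Representation k G V) {K : Subgroup G} (hK : KFinite ρ K)

/-- The level-`K` Hecke operator of `g`: `e_K ∘ ρ g ∘ e_K` on `V^K`. -/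
noncomputable def heckeOp (g : G) : invariants ρ K →ₗ[k] invariants ρ K :=
  levelIdempotentTo ρ hK ∘ₗ ρ g ∘ₗ (invariants ρ K).subtype

/-- `T_g x = e_K (ρ g x)` for `x ∈ V^K`. -/
@[simp] theorem heckeOp_apply (g : G) (x : invariants ρ K) :
    (heckeOp ρ hK g x : V) = levelAverage ρ K (ρ g x) :=
  rfl

/-- `T_{κ g} = T_g` for `κ ∈ K` (left absorption of `e_K`). -/
theorem heckeOp_mul_left {κ : G} (hκ : κ ∈ K) (g : G) : heckeOp ρ hK (κ * g) = heckeOp ρ hK g := by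
  refine LinearMap.ext fun x => Subtype.ext ?_
  rw [heckeOp_apply, heckeOp_apply, map_mul, Module.End.mul_apply]
  haveI := hK (ρ g x)
  exact levelAverage_apply (ρ := ρ) (⟨κ, hκ⟩ : K)

/-- `T_{g κ} = T_g` for `κ ∈ K` (`K`-invariance of the argument). -/
theorem heckeOp_mul_right (g : G) {κ : G} (hκ : κ ∈ K) : heckeOp ρ hK (g * κ) = heckeOp ρ hK g := by
  refine LinearMap.ext fun x => Subtype.ext ?_
  rw [heckeOp_apply, heckeOp_apply, map_mul, Module.End.mul_apply, mem_invariants_iff.1 x.2 κ hκ]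

/-- `T_g` depends only on the double coset `K g K`. -/
theorem heckeOp_doubleCoset {κ₁ κ₂ : G} (hκ₁ : κ₁ ∈ K) (hκ₂ : κ₂ ∈ K) (g : G) :
    heckeOp ρ hK (κ₁ * g * κ₂) = heckeOp ρ hK g := by
  rw [heckeOp_mul_right ρ hK _ hκ₂, heckeOp_mul_left ρ hK hκ₁]

/-- `T_1 = id`. -/
theorem heckeOp_one : heckeOp ρ hK 1 = LinearMap.id := by
  refine LinearMap.ext fun x => Subtype.ext ?_
  rw [heckeOp_apply, map_one, Module.End.one_apply, LinearMap.id_apply]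
  exact levelAverage_of_mem_invariants x.2

/-- `T_κ = id` for `κ ∈ K`. -/
theorem heckeOp_of_mem {κ : G} (hκ : κ ∈ K) : heckeOp ρ hK κ = LinearMap.id := by
  rw [← one_mul κ, heckeOp_mul_right ρ hK 1 hκ, heckeOp_one]

/-- The Hecke operator as the endomorphism `e_K ∘ ρ g ∘ e_K` of `V`, restricted to `V^K`. -/
theorem heckeOp_eq_restrict (g : G) (x : invariants ρ K) :
    (heckeOp ρ hK g x : V) = (levelIdempotent K hK ∘ₗ ρ g ∘ₗ levelIdempotent K hK) x := by
  rw [heckeOp_apply]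
  simp only [LinearMap.comp_apply, levelIdempotent_apply]
  rw [levelAverage_of_mem_invariants x.2]

/-- `e_K ∘ ρ g ∘ e_K` lies in the corner `e_K End_k(V) e_K`: it is absorbed by `e_K` on both
sides. -/
theorem levelIdempotent_comp_comp_levelIdempotent (g : G) :
    levelIdempotent (ρ := ρ) K hK ∘ₗ (levelIdempotent K hK ∘ₗ ρ g ∘ₗ levelIdempotent K hK) =
        levelIdempotent K hK ∘ₗ ρ g ∘ₗ levelIdempotent K hK ∧
      (levelIdempotent K hK ∘ₗ ρ g ∘ₗ levelIdempotent K hK) ∘ₗ levelIdempotent (ρ := ρ) K hK =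
        levelIdempotent K hK ∘ₗ ρ g ∘ₗ levelIdempotent K hK := by
  constructor
  · refine LinearMap.ext fun v => ?_
    simp only [LinearMap.comp_apply, levelIdempotent_apply]
    haveI := hK (ρ g (levelAverage ρ K v))
    exact levelAverage_levelAverage
  · refine LinearMap.ext fun v => ?_
    simp only [LinearMap.comp_apply, levelIdempotent_apply]
    haveI := hK v
    rw [levelAverage_levelAverage]

end Summit.Ventures.HodgeRepro2.T5HeckeOperator
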